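import Summits.HubbardSuperconductivity.HubbardSuperconductivity.Theorems.PerWidthThermodynamics.Negative.LadderFermiSea

/-!
# Localisation of the unpaired Fermi level of the free ladder: `sin(2π|a⋆|/L) ≥ 3/8`

Third file of the `U = 0` stiffness twin for crux stmt-HubbardSuperconductivity-18510. The gain of the
twist on an odd Fermi sea is proportional to `sin(2π|a⋆|/L)` for its unpaired level `k⋆ = (a⋆, b⋆)`
(`LadderFermiSea`); here this sine is bounded below uniformly in the doping window, sorry-free:

* two elementary trigonometric lemmas: `sin_ge_of_antibonding_case` (from `cos y⋆ - cos y ≤ 1`,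
  `cos y⋆ ≥ 0`, `(y + y⋆)/2 ≥ π/3`: product formula, `sin(π/5) > 1/√3` via `cos(π/5) = (1+√5)/4`, and
  `sin(2π/15) > 3/8` via `x - x³/6 < sin x`) and `sin_ge_of_bonding_case` (from `cos y⋆ ≤ cos y - 1`,
  `cos y⋆ ≥ cos y - 11/10`, `y + y⋆ < π`: `cos y > 1/2`, `sin y⋆ ≥ 4/5`);
* **`sin_fold_unpaired_ge`** — for a Fermi set with `L` even, `L ≥ 100`, `3·#F ≥ 2L + 6`, `#F + 6 ≤ L`
  (i.e. density per spin and site in `[1/3 + 1/L, 1/2 - 3/L]`, covering the cruxes' `δ ∈ (0, 3/10)`):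
  `sin(2π|a⋆|/L) ≥ 3/8`. The two Fermi momenta `y = 2πm/L` (top of the other band) and `y⋆ = 2π|a⋆|/L`
  are tied by the exchange inequalities `ε_{b̄}(m) ≤ ε_{b⋆}(|a⋆|) ≤ ε_{b̄}(m+1)` and by the level counts
  `2(|a⋆| + m) - 2 ≤ #F ≤ 2(|a⋆| + m) + 2`.

Folklore (free ladder Fermi points: bonding `k_F ∈ (π/2, 2π/3]`, antibonding `k_F ∈ [0.5, π/3)`).
No definitions, no named facts. REUSED: Mathlib `Real.cos_pi_div_five`, `Real.sin_gt_sub_cube`,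
`Real.cos_sub_cos`, `Real.abs_cos_sub_cos_le`; the Fermi-set API of `LadderFermiSea`.
-/

noncomputable section

namespace Summit.HubbardSuperconductivity.HubbardSuperconductivity.Theorems.PerWidthThermodynamics.Negative

set_option linter.dupNamespace false -- summit = problem name (single-conjunct summit), D-0017

open scoped BigOperators Classical
open Finset Summit.HubbardSuperconductivity.HubbardSuperconductivity.Theorems.WidthHaldane
open Summit.HubbardSuperconductivity.HubbardSuperconductivity.Theorems.WidthUniformThermodynamics.Negative

/-! ### Localisation of the unpaired (Fermi) level: two elementary trigonometric cases -/

section Trig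

open Real

/-- `3 sin²(π/5) > 1`, i.e. `sin(π/5) > 1/√3` (from `cos(π/5) = (1+√5)/4`: `sin²(π/5) = (5-√5)/8` and
`3√5 < 7`). [folklore] -/
theorem one_lt_three_mul_sin_sq_pi_div_five : 1 < 3 * Real.sin (π / 5) ^ 2 := by
  rw [Real.sin_sq, Real.cos_pi_div_five]
  have h5 : Real.sqrt 5 < 7 / 3 := by
    rw [Real.sqrt_lt' (by norm_num)]; norm_num
  have h5' : 0 ≤ Real.sqrt 5 := Real.sqrt_nonneg 5
  have hsq : Real.sqrt 5 ^ 2 = 5 := Real.sq_sqrt (by norm_num)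
  nlinarith

/-- `sin(2π/15) > 3/8` (cubic lower bound `x - x³/6 < sin x`). [folklore] -/
theorem sin_two_pi_div_fifteen_gt : 3 / 8 < Real.sin (2 * π / 15) := by
  have hu0 : 0.4188 < 2 * π / 15 := by linarith [Real.pi_gt_d4]
  have hu1 : 2 * π / 15 < 0.4189 := by linarith [Real.pi_lt_d4]
  have h := Real.sin_gt_sub_cube (x := 2 * π / 15) (by linarith)
  have hcube : (2 * π / 15) ^ 3 < 0.4189 ^ 3 := pow_lt_pow_left₀ hu1 (by linarith) (by norm_num)
  norm_num at hcube
  linarith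

/-- **Antibonding case.** If `0 ≤ y, y⋆ ≤ π`, `π/3 ≤ (y + y⋆)/2`, `y + y⋆ ≤ π`, `cos y⋆ - cos y ≤ 1`
and `0 ≤ cos y⋆`, then `sin y⋆ ≥ 3/8`: writing `cos y⋆ - cos y = 2 sin((y+y⋆)/2) sin((y-y⋆)/2)` with
`sin((y+y⋆)/2) ≥ √3/2` forces `sin((y-y⋆)/2) ≤ 1/√3 < sin(π/5)`, so `(y - y⋆)/2 < π/5` and
`y⋆ > π/3 - π/5 = 2π/15`, `sin y⋆ ≥ sin(2π/15) > 3/8` (`y⋆ ≤ π/2` by `cos y⋆ ≥ 0`). [folklore] -/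
theorem sin_ge_of_antibonding_case {y ys : ℝ} (hy0 : 0 ≤ y) (hyπ : y ≤ π) (hys0 : 0 ≤ ys)
    (hs : π / 3 ≤ (y + ys) / 2) (hs' : y + ys ≤ π) (hI1 : Real.cos ys - Real.cos y ≤ 1)
    (hI2 : 0 ≤ Real.cos ys) : 3 / 8 ≤ Real.sin ys := by
  -- `ys ≤ π/2`
  have hysπ2 : ys ≤ π / 2 := by
    by_contra h
    push Not at h
    have := Real.cos_neg_of_pi_div_two_lt_of_lt h (by linarith)
    linarith
  -- product formula
  have hprod : Real.cos ys - Real.cos y = 2 * Real.sin ((y + ys) / 2) * Real.sin ((y - ys) / 2) := by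
    rw [Real.cos_sub_cos]
    have : Real.sin ((ys - y) / 2) = -Real.sin ((y - ys) / 2) := by
      rw [← Real.sin_neg]; congr 1; ring
    rw [this]; ring_nf
  have hsin_s : Real.sqrt 3 / 2 ≤ Real.sin ((y + ys) / 2) := by
    rw [← Real.sin_pi_div_three]
    exact Real.sin_le_sin_of_le_of_le_pi_div_two (by linarith [Real.pi_pos]) (by linarith) hs
  -- `(y - ys)/2 < π/5`
  have hd : (y - ys) / 2 < π / 5 := by
    by_contra h
    push Not at h
    have hd2 : (y - ys) / 2 ≤ π / 2 := by linarith
    have hsin_d : Real.sin (π / 5) ≤ Real.sin ((y - ys) / 2) :=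
      Real.sin_le_sin_of_le_of_le_pi_div_two (by linarith [Real.pi_pos]) hd2 h
    have h5pos : 0 < Real.sin (π / 5) := Real.sin_pos_of_pos_of_lt_pi (by positivity) (by linarith [Real.pi_pos])
    have h3 := one_lt_three_mul_sin_sq_pi_div_five
    have hsqrt3 : Real.sqrt 3 ^ 2 = 3 := Real.sq_sqrt (by norm_num)
    have hsqrt3' : 0 ≤ Real.sqrt 3 := Real.sqrt_nonneg 3
    -- `1 ≥ cos ys - cos y ≥ √3 · sin(π/5)`, but `(√3 sin(π/5))² = 3 sin² > 1`
    have hge : Real.sqrt 3 * Real.sin (π / 5) ≤ 1 := by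
      calc Real.sqrt 3 * Real.sin (π / 5) = 2 * (Real.sqrt 3 / 2) * Real.sin (π / 5) := by ring
        _ ≤ 2 * Real.sin ((y + ys) / 2) * Real.sin ((y - ys) / 2) := by
            apply mul_le_mul (by linarith) hsin_d h5pos.le
            linarith [mul_nonneg (show (0:ℝ) ≤ 2 by norm_num) (le_trans (by positivity) hsin_s)]
        _ ≤ 1 := by rw [← hprod]; exact hI1
    have hx : 0 ≤ Real.sqrt 3 * Real.sin (π / 5) := mul_nonneg hsqrt3' h5pos.le
    have hx2 : (Real.sqrt 3 * Real.sin (π / 5)) ^ 2 ≤ 1 := pow_le_one₀ hx hge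
    rw [mul_pow, hsqrt3] at hx2
    linarith
  -- hence `ys > 2π/15` and `sin ys ≥ sin(2π/15) > 3/8`
  have hys : 2 * π / 15 ≤ ys := by linarith
  have hmono : Real.sin (2 * π / 15) ≤ Real.sin ys :=
    Real.sin_le_sin_of_le_of_le_pi_div_two (by linarith [Real.pi_pos]) hysπ2 hys
  linarith [sin_two_pi_div_fifteen_gt]

/-- **Bonding case.** If `0 ≤ y⋆`, `0 ≤ y`, `y + y⋆ < π`, `cos y⋆ ≤ cos y - 1` and
`cos y - 11/10 ≤ cos y⋆`, then `sin y⋆ ≥ 3/8`: `cos y⋆ > cos(π - y) = -cos y` gives `cos y > 1/2`,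
so `cos y⋆ ∈ [-3/5, 0]` and `sin y⋆ ≥ 4/5`. [folklore] -/
theorem sin_ge_of_bonding_case {y ys : ℝ} (hy0 : 0 ≤ y) (hys0 : 0 ≤ ys) (hs' : y + ys < π)
    (hI1 : Real.cos ys ≤ Real.cos y - 1) (hI2 : Real.cos y - 11 / 10 ≤ Real.cos ys) :
    3 / 8 ≤ Real.sin ys := by
  have hlt : Real.cos (π - y) < Real.cos ys :=
    Real.cos_lt_cos_of_nonneg_of_le_pi hys0 (by linarith) (by linarith)
  rw [Real.cos_pi_sub] at hlt
  have hcy : 1 / 2 < Real.cos y := by linarith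
  have hlo : -(3 / 5) ≤ Real.cos ys := by linarith
  have hhi : Real.cos ys ≤ 0 := by linarith [Real.cos_le_one y]
  have hsin_nn : 0 ≤ Real.sin ys := Real.sin_nonneg_of_nonneg_of_le_pi hys0 (by linarith)
  have hpyth := Real.sin_sq_add_cos_sq ys
  nlinarith

end Trig

/-! ### The unpaired level of an odd Fermi sea sits at a Fermi point with `sin ≥ 3/8` -/

section Localisation

variable {L : ℕ} [NeZero L] {F : Finset (ZMod L × ZMod 2)} {μ : ℝ}

/-- **Localisation of the unpaired level.** Let `F` be a Fermi set of the free ladder (`L` even,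
`L ≥ 100`) with `3·#F ≥ 2L + 6` and `#F + 6 ≤ L`, and let `k⋆ = (a⋆, b⋆) ∈ F` be unpaired
(`(-a⋆, b⋆) ∉ F`). Then `sin(2π|a⋆|/L) ≥ 3/8`. With `m` the largest `|a|` occupied in the other band:
the exchange inequalities `ε_{b̄}(m) ≤ ε_{b⋆}(|a⋆|) ≤ ε_{b̄}(m+1)` and the counts
`2(|a⋆| + m) - 2 ≤ #F ≤ 2(|a⋆| + m) + 2` feed `sin_ge_of_antibonding_case` (`b⋆ = 1`) resp.
`sin_ge_of_bonding_case` (`b⋆ = 0`). [folklore] -/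
theorem sin_fold_unpaired_ge (hF : ∀ k ∈ F, ladderTwistedBand L 0 k ≤ μ)
    (hF' : ∀ k ∉ F, μ ≤ ladderTwistedBand L 0 k) (hLe : Even L) (hL : 100 ≤ L)
    (h3n : 2 * L + 6 ≤ 3 * F.card) (hn6 : F.card + 6 ≤ L) {ks : ZMod L × ZMod 2} (hks : ks ∈ F)
    (hksc : ((-ks.1, ks.2) : ZMod L × ZMod 2) ∉ F) :
    3 / 8 ≤ Real.sin (2 * Real.pi * ((min ks.1.val (L - ks.1.val) : ℕ) : ℝ) / L) := by
  have hL0 : (0 : ℝ) < L := by exact_mod_cast (show 0 < L by omega)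
  have hLr : (100 : ℝ) ≤ L := by exact_mod_cast hL
  have hsmall : F.card < L := by omega
  have hbig : L / 2 + 2 ≤ F.card := by omega
  -- the unpaired level: `r = |a⋆|`, `1 ≤ r`, `2r + 2 ≤ L`
  set r : ℕ := min ks.1.val (L - ks.1.val) with hr
  have hr1 : 1 ≤ r := by
    by_contra h0
    have h0' : r = 0 := by omega
    rw [hr, fold_eq_zero_iff] at h0'
    apply hksc
    have : ((-ks.1, ks.2) : ZMod L × ZMod 2) = ks := Prod.ext (by simp [h0']) rfl
    rw [this]; exact hks
  have hrL : 2 * r + 2 ≤ L := by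
    have h2 := two_mul_fold_le ks.1
    have hne : r ≠ L / 2 := by
      intro h
      rw [hr, fold_eq_half_iff hLe] at h
      apply half_not_mem hF hF' hLe hsmall ks.2
      have : ks = ((((L / 2 : ℕ) : ZMod L)), ks.2) := Prod.ext h rfl
      rw [← this]; exact hks
    obtain ⟨l, hl⟩ := hLe
    omega
  -- the other band and its top occupied level `m`
  set bb : ZMod 2 := ks.2 + 1 with hbb
  have hbb_ne : bb ≠ ks.2 := by
    rw [hbb]; rcases ((by decide : ∀ b : ZMod 2, b = 0 ∨ b = 1) ks.2) with h | h <;> rw [h] <;> decide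
  have hzero_mem : ((0 : ZMod L), bb) ∈ F := by
    rcases ((by decide : ∀ b : ZMod 2, b = 0 ∨ b = 1) bb) with h | h
    · rw [h]; exact zero_zero_mem hF hF' (card_pos.1 (by omega))
    · rw [h]; exact zero_one_mem hF hF' hbig
  have hne : (F.filter fun k => k.2 = bb).Nonempty := ⟨(0, bb), mem_filter.2 ⟨hzero_mem, rfl⟩⟩
  obtain ⟨km, hkm, hmax⟩ := Finset.exists_max_image (F.filter fun k => k.2 = bb)
    (fun k => min k.1.val (L - k.1.val)) hne
  rw [mem_filter] at hkm
  set m : ℕ := min km.1.val (L - km.1.val) with hm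
  have hmax' : ∀ k ∈ F, k.2 = bb → min k.1.val (L - k.1.val) ≤ m := fun k hk hk2 =>
    hmax k (mem_filter.2 ⟨hk, hk2⟩)
  have hmL : 2 * m + 2 ≤ L := by
    have h2 := two_mul_fold_le km.1
    have hne : m ≠ L / 2 := by
      intro h
      rw [hm, fold_eq_half_iff hLe] at h
      apply half_not_mem hF hF' hLe hsmall km.2
      have : km = ((((L / 2 : ℕ) : ZMod L)), km.2) := Prod.ext h rfl
      rw [← this]; exact hkm.1
    obtain ⟨l, hl⟩ := hLe
    omega
  -- the level just above `m` in the other band is empty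
  set kp : ZMod L × ZMod 2 := ((((m + 1 : ℕ) : ZMod L)), bb) with hkp
  have hkp_fold : min kp.1.val (L - kp.1.val) = m + 1 := fold_natCast (by omega)
  have hkp_nm : kp ∉ F := by
    intro h
    have := hmax' kp h rfl
    rw [hkp_fold] at this
    omega
  -- the exchange inequalities
  have hI1 : ladderTwistedBand L 0 km ≤ ladderTwistedBand L 0 ks := by
    have h1 := hF km hkm.1
    have h2 := hF' _ hksc
    rw [ladderBand_zero_conj] at h2
    linarith
  have hI2 : ladderTwistedBand L 0 ks ≤ ladderTwistedBand L 0 kp := by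
    have h1 := hF ks hks
    have h2 := hF' _ hkp_nm
    linarith
  rw [ladderBand_zero_eq, ladderBand_zero_eq, ← hm, ← hr, hkm.2] at hI1
  rw [ladderBand_zero_eq, ladderBand_zero_eq, hkp_fold, ← hr] at hI2
  change _ ≤ -2 * Real.cos (2 * Real.pi * ((m + 1 : ℕ) : ℝ) / L) - (-1) ^ bb.val at hI2
  -- the counts
  have hC1 : F.card ≤ (2 * r + 1) + (2 * m + 1) := by
    have hsub : F ⊆ (univ.filter fun a : ZMod L => min a.val (L - a.val) ≤ r).image (fun a => (a, ks.2)) ∪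
        (univ.filter fun a : ZMod L => min a.val (L - a.val) ≤ m).image (fun a => (a, bb)) := by
      intro k hk
      rw [mem_union, mem_image, mem_image]
      rcases ((by decide : ∀ b b₀ : ZMod 2, b = b₀ ∨ b = b₀ + 1) k.2 ks.2) with h2 | h2
      · left
        refine ⟨k.1, mem_filter.2 ⟨mem_univ _, ?_⟩, Prod.ext rfl h2.symm⟩
        have h := fold_le_of_mem_of_not_mem hF hF' hk hksc h2
        simp only at h
        rw [fold_neg] at h
        exact h
      · right
        exact ⟨k.1, mem_filter.2 ⟨mem_univ _, hmax' k hk h2⟩, Prod.ext rfl h2.symm⟩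
    refine (card_le_card hsub).trans ((card_union_le _ _).trans ?_)
    rw [card_image_of_injective _ (fun a a' h => (Prod.ext_iff.1 h).1),
      card_image_of_injective _ (fun a a' h => (Prod.ext_iff.1 h).1),
      card_filter_fold_le r (by omega), card_filter_fold_le m (by omega)]
  have hC2 : (2 * r - 1) + (2 * m - 1) ≤ F.card := by
    have hsubA : (univ.filter fun a : ZMod L => min a.val (L - a.val) < r).image (fun a => (a, ks.2)) ⊆ F := by
      intro k hk
      obtain ⟨a, ha, rfl⟩ := mem_image.1 hk
      exact mem_of_fold_lt hF hF' hks rfl (mem_filter.1 ha).2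
    have hsubB : (univ.filter fun a : ZMod L => min a.val (L - a.val) < m).image (fun a => (a, bb)) ⊆ F := by
      intro k hk
      obtain ⟨a, ha, rfl⟩ := mem_image.1 hk
      exact mem_of_fold_lt hF hF' hkm.1 hkm.2.symm (mem_filter.1 ha).2
    have hdisj : Disjoint
        ((univ.filter fun a : ZMod L => min a.val (L - a.val) < r).image (fun a => (a, ks.2)))
        ((univ.filter fun a : ZMod L => min a.val (L - a.val) < m).image (fun a => (a, bb))) := by
      rw [Finset.disjoint_left]
      intro k hkA hkB
      obtain ⟨a, -, rfl⟩ := mem_image.1 hkA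
      obtain ⟨a', -, h⟩ := mem_image.1 hkB
      exact hbb_ne (Prod.ext_iff.1 h).2
    have h := card_le_card (union_subset hsubA hsubB)
    rwa [card_union_of_disjoint hdisj, card_image_of_injective _ (fun a a' h => (Prod.ext_iff.1 h).1),
      card_image_of_injective _ (fun a a' h => (Prod.ext_iff.1 h).1),
      card_filter_fold_lt (by omega), card_filter_fold_lt (by omega)] at h
  -- real bookkeeping: `y = 2πm/L`, `ys = 2πr/L`
  have hmr_lo : (L : ℝ) ≤ 3 * ((m : ℝ) + r) := by
    have : L ≤ 3 * (m + r) := by omega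
    exact_mod_cast this
  have hmr_hi : 2 * ((m : ℝ) + r) + 4 ≤ L := by
    have : 2 * (m + r) + 4 ≤ L := by omega
    exact_mod_cast this
  set y : ℝ := 2 * Real.pi * (m : ℝ) / L with hy
  set ys : ℝ := 2 * Real.pi * (r : ℝ) / L with hys
  have hy0 : 0 ≤ y := by positivity
  have hys0 : 0 ≤ ys := by positivity
  have hsum : y + ys = 2 * Real.pi * ((m : ℝ) + r) / L := by rw [hy, hys]; ring
  have hs : Real.pi / 3 ≤ (y + ys) / 2 := by
    rw [hsum]
    have e : 2 * Real.pi * ((m : ℝ) + r) / L / 2 = Real.pi * ((m : ℝ) + r) / L := by ring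
    rw [e, le_div_iff₀ hL0]
    nlinarith [Real.pi_pos]
  have hs' : y + ys + 4 * Real.pi / L ≤ Real.pi := by
    rw [hsum, ← add_div, div_le_iff₀ hL0]
    nlinarith [Real.pi_pos]
  have h4 : 0 < 4 * Real.pi / L := by positivity
  have hyπ : y ≤ Real.pi := by linarith
  -- `|cos y'' - cos y| ≤ 2π/L ≤ 1/10`
  have hlip : |Real.cos (2 * Real.pi * ((m + 1 : ℕ) : ℝ) / L) - Real.cos y| ≤ 1 / 10 := by
    refine (Real.abs_cos_sub_cos_le _ _).trans ?_
    rw [hy, show 2 * Real.pi * ((m + 1 : ℕ) : ℝ) / L - 2 * Real.pi * (m : ℝ) / L = 2 * Real.pi / L by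
      push_cast; ring, abs_of_pos (by positivity), div_le_iff₀ hL0]
    nlinarith [Real.pi_lt_d2]
  have hlip' := (abs_le.1 hlip).1
  -- case analysis on the band of the unpaired level
  rcases ((by decide : ∀ b : ZMod 2, b = 0 ∨ b = 1) ks.2) with hb | hb
  · -- bonding band `b⋆ = 0`, other band `bb = 1`
    have hbb1 : bb = 1 := by rw [hbb, hb]; decide
    rw [hb, hbb1, ZMod.val_zero, ZMod.val_one, pow_zero, pow_one] at hI1
    rw [hb, hbb1, ZMod.val_zero, ZMod.val_one, pow_zero, pow_one] at hI2
    change -2 * Real.cos y - -1 ≤ -2 * Real.cos ys - 1 at hI1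
    change -2 * Real.cos ys - 1 ≤ _ at hI2
    exact sin_ge_of_bonding_case hy0 hys0 (by linarith) (by linarith) (by linarith)
  · -- antibonding band `b⋆ = 1`, other band `bb = 0`
    have hbb0 : bb = 0 := by rw [hbb, hb]; decide
    rw [hb, hbb0, ZMod.val_zero, ZMod.val_one, pow_zero, pow_one] at hI1
    rw [hb, hbb0, ZMod.val_zero, ZMod.val_one, pow_zero, pow_one] at hI2
    change -2 * Real.cos y - 1 ≤ -2 * Real.cos ys - -1 at hI1
    change -2 * Real.cos ys - -1 ≤ _ at hI2
    have hcos'' : -1 ≤ Real.cos (2 * Real.pi * ((m + 1 : ℕ) : ℝ) / L) := Real.neg_one_le_cos _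
    exact sin_ge_of_antibonding_case hy0 hyπ hys0 hs (by linarith) (by linarith) (by linarith)

end Localisation

end Summit.HubbardSuperconductivity.HubbardSuperconductivity.Theorems.PerWidthThermodynamics.Negative

end
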